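import Literature.NumberTheory.Automorphic.LevelControlFiniteLevel
import Literature.NumberTheory.Automorphic.LevelActionTopVanishing
import Literature.NumberTheory.Automorphic.HidaLevelHeckeEquivarianceCoeff
import Literature.NumberTheory.Automorphic.HidaLatticeHeckeCommutative
import Literature.NumberTheory.Automorphic.HidaEngineSymbols
import HarnessLib

/-!
# Finite-level control in the top degree for the Hida levels `U(c,c) ⊴ U(b₁,c)`, torus sections

Topic `NumberTheory/Automorphic`; namespace `Literature.NumberTheory.Automorphic.BigHeckeGLn.TameLevel`;
one definition with body (`torusSection`) and theorems; no named fact, no `sorry`.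

`GL₂` over a number field `K`, tame level `U` maximal above `p`, ARBITRARY flat coefficients
`τ : Δ → End V` on a monoid `Δ` containing the levels (e.g. `⨂_τ Sym^{k−2}(S²)` on the integral
monoid).  For `U = U(c,c) ⊴ U' = U(b₁,c)` (`b₁ ≤ c`, `1 ≤ c`), `Q = U'/U`:

* `level_le_integralMonoid_of_forall_mem` — the levels lie in the integral monoid of every family of
  places above `p`;
* **`torusSection`** — a section `Q → U'` by TORUS elements `torusElement d_q`, `d_q` a torus datum of
  depth `c₀` (`e_v c₀ ≤ b₁` for all `v ∣ p`; `HidaEngineSymbols.exists_torusDatum_mul_inv_mem_level`), so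
  that the diamond operators `⟨s q⟩` of the control theorems ARE the symbol operators `X_{d_q}`;
* **`exists_eq_sum_of_trCohomology_eq_zero_level_two`** — `ker (tr : H²(U, τ) → H²(U', τ)) =
  ∑_q (⟨d_q⟩ − 1) H²(U, τ)` (B4 of `LevelControlFiniteLevel`), GIVEN `cd ≤ 2` at neat levels (`hcd`)
  and the neatness of `U'` (`htf`): the vanishing `H³(𝓕 K) = 0` is `LevelActionTopVanishing`;
* `trCohomology_surjective_level_two` — `tr` is onto in degree `2` (B3);
* `trCohomology_comp_heckeCohomology_torusElement`, `trCohomology_comp_symOp`,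
  `trCohomology_symPolyHom_apply` — `tr` commutes with the torus operators, with all symbol operators,
  and with the polynomial action `π` of `O[Syms]` (on the integral monoid of a family of places above `p`).

[cite: KhareThorne2017, §6.3, Prop. 6.6, Lemma 6.9] [cite: Hida1994AIF, §3, (3.5), Thm 3.2]

## References

* C. Khare, J. A. Thorne, Amer. J. Math. 139 (2017), §6.2–6.3 (arXiv:1409.7007, held). [KhareThorne2017]
* H. Hida, Ann. Inst. Fourier 44 (1994), §2–3 (held). [Hida1994AIF]
* A. Borel, J.-P. Serre, Comment. Math. Helv. 48 (1973), §11.1 (vcd of Bianchi groups). [BorelSerre1973]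
-/

noncomputable section

open CategoryTheory IsDedekindDomain MvPolynomial
open scoped NumberField

namespace Literature.NumberTheory.Automorphic

namespace BigHeckeGLn

namespace TameLevel

open IntegralWeightGL2 LevelAction ParallelWeight

variable {K : Type} [Field K] [NumberField K] {p : ℕ} [Fact p.Prime] (𝒰 : TameLevel 2 K p)

/-! ### Levels inside the integral monoid -/

/-- **`U(b,c)` lies in the integral monoid** of every family of places above `p`. [folklore] -/
theorem level_le_integralMonoid_of_forall_mem {E : Type} [Field E] {v : (K →+* E) → HeightOneSpectrum (𝓞 K)}
    (hv : ∀ τ, (p : 𝓞 K) ∈ (v τ).asIdeal) (b c : ℕ) :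
    (𝒰.level b c).toSubmonoid ≤ integralMonoid K v := fun u hu =>
  (mem_integralMonoid_iff u).2 fun τ i j => by
    have hloc := ((𝒰.mem_level_iff b c u).1 hu).2 (v τ) (hv τ)
    exact (HeightOneSpectrum.mem_adicCompletionIntegers (R := 𝓞 K) K _).2
      ((mem_valuedIwahoriSubgroup_iff.1 hloc).1.le_one i j)

/-- The quotient `U(b₁,c)/U(c,c)` is finite (as an instance). [folklore] -/
instance fintypeLevelQuot (b₁ c : ℕ) : Fintype (𝒰.level b₁ c ⧸ (𝒰.level c c).subgroupOf (𝒰.level b₁ c)) :=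
  @Fintype.ofFinite _ (𝒰.finite_quotient_level b₁ c)

/-! ### Torus sections of `U(b₁,c)/U(c,c)` -/

section Torus

variable (h𝒰 : 𝒰.IsMaximalAbove) {c₀ b₁ c : ℕ} (hb₁ : ∀ v : PlacesAbove K p, ordAt v.1 (p : 𝓞 K) * c₀ ≤ b₁)
  (hbc : b₁ ≤ c) (hc : 1 ≤ c)

/-- **A torus datum `d_q` of depth `c₀` with `torusElement d_q ∈ q`** for each coset
`q ∈ U(b₁,c)/U(c,c)`. [cite: KhareThorne2017, §6.3] -/
def torusSection (q : 𝒰.level b₁ c ⧸ (𝒰.level c c).subgroupOf (𝒰.level b₁ c)) : TorusDatum K p c₀ :=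
  Classical.choose (𝒰.exists_torusDatum_mul_inv_mem_level h𝒰 hb₁ hbc hc (Quotient.out q).2)

/-- The defining property: `q.out · (torusElement d_q)⁻¹ ∈ U(c,c)`. [folklore] -/
theorem out_mul_torusElement_inv_mem (q : 𝒰.level b₁ c ⧸ (𝒰.level c c).subgroupOf (𝒰.level b₁ c)) :
    ((Quotient.out q : 𝒰.level b₁ c) : FiniteAdelicGL 2 K) * (𝒰.torusSection h𝒰 hb₁ hbc hc q).torusElement⁻¹ ∈
      𝒰.level c c :=
  Classical.choose_spec (𝒰.exists_torusDatum_mul_inv_mem_level h𝒰 hb₁ hbc hc (Quotient.out q).2)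

/-- `torusElement d_q ∈ U(b₁,c)`. [folklore] -/
theorem torusElement_torusSection_mem (q : 𝒰.level b₁ c ⧸ (𝒰.level c c).subgroupOf (𝒰.level b₁ c)) :
    (𝒰.torusSection h𝒰 hb₁ hbc hc q).torusElement ∈ 𝒰.level b₁ c := by
  have h := 𝒰.out_mul_torusElement_inv_mem h𝒰 hb₁ hbc hc q
  have h' : (((Quotient.out q : 𝒰.level b₁ c) : FiniteAdelicGL 2 K) *
      (𝒰.torusSection h𝒰 hb₁ hbc hc q).torusElement⁻¹)⁻¹ * ((Quotient.out q : 𝒰.level b₁ c) : FiniteAdelicGL 2 K) ∈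
        𝒰.level b₁ c :=
    mul_mem (inv_mem (𝒰.level_antitone hbc le_rfl h)) (Quotient.out q).2
  rwa [mul_inv_rev, inv_inv, mul_assoc, inv_mul_cancel, mul_one] at h'

/-- **The torus section `q ↦ torusElement d_q ∈ U(b₁,c)`.** [folklore] -/
def torusSectionElt (q : 𝒰.level b₁ c ⧸ (𝒰.level c c).subgroupOf (𝒰.level b₁ c)) : 𝒰.level b₁ c :=
  ⟨(𝒰.torusSection h𝒰 hb₁ hbc hc q).torusElement, 𝒰.torusElement_torusSection_mem h𝒰 hb₁ hbc hc q⟩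

/-- It is a section of `π : U(b₁,c) → U(b₁,c)/U(c,c)`. [folklore] -/
theorem mk'_torusSectionElt [((𝒰.level c c).subgroupOf (𝒰.level b₁ c)).Normal]
    (q : 𝒰.level b₁ c ⧸ (𝒰.level c c).subgroupOf (𝒰.level b₁ c)) :
    QuotientGroup.mk' ((𝒰.level c c).subgroupOf (𝒰.level b₁ c)) (𝒰.torusSectionElt h𝒰 hb₁ hbc hc q) = q := by
  conv_rhs => rw [← QuotientGroup.out_eq' q]
  rw [QuotientGroup.mk'_apply, QuotientGroup.eq, Subgroup.mem_subgroupOf]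
  -- `t⁻¹ s = t⁻¹ (s t⁻¹) t ∈ U(c,c)` (normality under the torus element)
  have h := 𝒰.out_mul_torusElement_inv_mem h𝒰 hb₁ hbc hc q
  have h2 := 𝒰.torusElement_conj_mem_level h𝒰 c c (𝒰.torusSection h𝒰 hb₁ hbc hc q) h
  change (𝒰.torusSection h𝒰 hb₁ hbc hc q).torusElement⁻¹ * ((Quotient.out q : 𝒰.level b₁ c) : FiniteAdelicGL 2 K) ∈ _
  rwa [mul_assoc, mul_assoc, inv_mul_cancel, mul_one] at h2

/-- The kernel of `π` is `U(c,c)` (the form used by the control theorems). [folklore] -/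
theorem mk'_eq_one_iff [((𝒰.level c c).subgroupOf (𝒰.level b₁ c)).Normal] (u : 𝒰.level b₁ c) :
    QuotientGroup.mk' ((𝒰.level c c).subgroupOf (𝒰.level b₁ c)) u = 1 ↔ (u : FiniteAdelicGL 2 K) ∈ 𝒰.level c c :=
  (𝒰.mem_level_iff_mk'_eq_one u).symm

end Torus

/-! ### Top-degree control: the kernel and the image of the transfer -/

section Top

variable {R : Type} [CommRing R] {V : Type} [AddCommGroup V] [Module R V] [Module.Flat R V]
  {Δ : Submonoid (FiniteAdelicGL 2 K)} (τ : Δ →* Module.End R V)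
  (h𝒰 : 𝒰.IsMaximalAbove) {c₀ b₁ c : ℕ} (hb₁ : ∀ v : PlacesAbove K p, ordAt v.1 (p : 𝓞 K) * c₀ ≤ b₁)
  (hbc : b₁ ≤ c) (hc : 1 ≤ c) [((𝒰.level c c).subgroupOf (𝒰.level b₁ c)).Normal]
  (hU : (𝒰.level c c).toSubmonoid ≤ Δ) (hU' : (𝒰.level b₁ c).toSubmonoid ≤ Δ)
  (hcd : ∀ (W : Subgroup (FiniteAdelicGL 2 K)),
    IsOpen (W : Set (FiniteAdelicGL 2 K)) → IsCompact (W : Set (FiniteAdelicGL 2 K)) →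
    (∀ γ ∈ W.comap (globalEmbedding 2 K), IsOfFinOrder γ → γ = 1) →
    ∀ (A : Rep ℤ (W.comap (globalEmbedding 2 K))) (q : ℕ), 3 ≤ q → Subsingleton (groupCohomology A q))
  (htf : ∀ (x : FiniteAdelicGL 2 K) (γ : GL (Fin 2) K), IsOfFinOrder γ →
    x⁻¹ * globalEmbedding 2 K γ * x ∈ 𝒰.level b₁ c → γ = 1)

omit [Module.Flat R V] [((𝒰.level c c).subgroupOf (𝒰.level b₁ c)).Normal] in
include hcd htf in
/-- `H³(Γ, 𝓕(N)) = 0` for every induced coefficient system at the neat level `U(b₁,c)`. [cite: BorelSerre1973, §11.1] -/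
theorem subsingleton_inducedCohomology_three {Q : Type} [Group Q] (π : 𝒰.level b₁ c →* Q)
    {N : Type} [AddCommGroup N] [Module R N] (ρ : Representation R Q N) :
    Subsingleton (groupCohomology (inducedRep (globalEmbedding 2 K) τ hU' π ρ) 3) :=
  subsingleton_cohomology_two_of_cd K hcd (𝒰.level b₁ c) (𝒰.isOpen_level b₁ c) (𝒰.isCompact_level b₁ c) htf
    _ le_rfl _ le_rfl

include h𝒰 hbc hcd htf in
/-- **B4 for the Hida levels: `ker tr = ∑_q (⟨d_q⟩ − 1) H²(U(c,c), τ)`** in degree `2`, GIVEN `cd ≤ 2` at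
neat levels and the neatness of `U(b₁,c)`. [cite: KhareThorne2017, §6.3, Prop. 6.6] [cite: Hida1994AIF, §3, Thm 3.2] -/
theorem exists_eq_sum_of_trCohomology_eq_zero_level_two
    (x : cohomology (globalEmbedding 2 K) Δ τ (𝒰.level c c) 2)
    (hx : (trCohomology (globalEmbedding 2 K) Δ τ hU hU' 2).hom x = 0) :
    ∃ b : (𝒰.level b₁ c ⧸ (𝒰.level c c).subgroupOf (𝒰.level b₁ c)) → cohomology (globalEmbedding 2 K) Δ τ (𝒰.level c c) 2,
      x = ∑ q, (heckeCohomology (globalEmbedding 2 K) Δ τ (𝒰.level c c) hU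
        (hU' (𝒰.torusSectionElt h𝒰 hb₁ hbc hc q).2) 2 (b q) - b q) := by
  classical
  haveI := 𝒰.subsingleton_inducedCohomology_three τ hU' hcd htf
    (QuotientGroup.mk' ((𝒰.level c c).subgroupOf (𝒰.level b₁ c))) (sumDiffKerRep R _)
  exact exists_eq_sum_of_trCohomology_eq_zero (globalEmbedding 2 K) τ hU hU' (𝒰.level_antitone hbc le_rfl)
    (QuotientGroup.mk' _) (fun u => 𝒰.mk'_eq_one_iff u) (𝒰.torusSectionElt h𝒰 hb₁ hbc hc)
    (fun q => 𝒰.mk'_torusSectionElt h𝒰 hb₁ hbc hc q) 2 x hx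

include h𝒰 hb₁ hbc hc hcd htf in
/-- **B3 for the Hida levels: `tr : H²(U(c,c), τ) → H²(U(b₁,c), τ)` is surjective.**
[cite: KhareThorne2017, §6.3, Prop. 6.6] -/
theorem trCohomology_surjective_level_two :
    Function.Surjective (trCohomology (globalEmbedding 2 K) Δ τ hU hU' 2).hom := by
  classical
  haveI := 𝒰.subsingleton_inducedCohomology_three τ hU' hcd htf
    (QuotientGroup.mk' ((𝒰.level c c).subgroupOf (𝒰.level b₁ c))) (augKerRep R _)
  exact trCohomology_surjective (globalEmbedding 2 K) τ hU hU' (𝒰.level_antitone hbc le_rfl)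
    (QuotientGroup.mk' _) (fun u => 𝒰.mk'_eq_one_iff u) (𝒰.torusSectionElt (c₀ := c₀) h𝒰 hb₁ hbc hc)
    (fun q => 𝒰.mk'_torusSectionElt h𝒰 hb₁ hbc hc q) 2

end Top

/-! ### `tr` commutes with the torus operators and with the polynomial action of the symbols -/

section Equivariance

variable {R : Type} [CommRing R] {V : Type} [AddCommGroup V] [Module R V]
  {Δ : Submonoid (FiniteAdelicGL 2 K)} (τ : Δ →* Module.End R V)
  (h𝒰 : 𝒰.IsMaximalAbove) {b' b c : ℕ} (hb : b' ≤ b) (hbc : b ≤ c) (hc : 1 ≤ c)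
  (hU : (𝒰.level b c).toSubmonoid ≤ Δ) (hU' : (𝒰.level b' c).toSubmonoid ≤ Δ)

include h𝒰 hb hbc hc in
/-- **`tr ∘ ⟨u⟩ = ⟨u⟩ ∘ tr`** for the torus elements `diamondPi u` (they normalise every level and commute
with the diamond transversal). [cite: Hida1994AIF, §2] -/
theorem trCohomology_comp_heckeCohomology_diamondPi
    (u : ∀ w : PlacesAbove K p, (Fin 2 → (w.1.adicCompletionIntegers K)ˣ)) (hu : diamondPi 2 K p u ∈ Δ) (i : ℕ) :
    (trCohomology (globalEmbedding 2 K) Δ τ hU hU' i).hom ∘ₗ heckeCohomology (globalEmbedding 2 K) Δ τ (𝒰.level b c) hU hu i =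
      heckeCohomology (globalEmbedding 2 K) Δ τ (𝒰.level b' c) hU' hu i ∘ₗ (trCohomology (globalEmbedding 2 K) Δ τ hU hU' i).hom := by
  classical
  have hle : 𝒰.level b c ≤ 𝒰.level b' c := 𝒰.level_antitone hb le_rfl
  obtain ⟨S, hSb, hS⟩ := 𝒰.exists_diamond_transversal h𝒰 hbc (le_max_of_le_right hc) (b' := b')
  have hS' := bijOn_image_of_bijOn (diamondPi 2 K p) hS
  refine trCohomology_comp_heckeCohomology (globalEmbedding 2 K) Δ τ hU hU' hle hS' hu (fun _ : Unit => diamondPi 2 K p u)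
    (fun _ => hu) (bijOn_unit_of_normalizing _ fun x hx => 𝒰.diamondPi_conj_mem_level h𝒰 b c u hx)
    (bijOn_unit_of_normalizing _ fun x hx => 𝒰.diamondPi_conj_mem_level h𝒰 b' c u hx) (fun _ j => j) (fun s hs j => ?_) i
  obtain ⟨u', -, rfl⟩ := Finset.mem_image.1 hs
  rw [← map_mul, ← map_mul, mul_comm]

variable {E : Type} [Field E] {v : (K →+* E) → HeightOneSpectrum (𝓞 K)} (hv : ∀ τ, (p : 𝓞 K) ∈ (v τ).asIdeal)

include h𝒰 hv in
/-- The unipotent representatives `N(x) t_w` (`x` integral, `w ∣ p`) lie in the integral monoid. [folklore] -/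
theorem globalUnipotent_mul_heckeElement_mem_integralMonoid {w : HeightOneSpectrum (𝓞 K)} (hw : (p : 𝓞 K) ∈ w.asIdeal)
    {x : w.adicCompletion K} (hx : Valued.v x ≤ 1) :
    globalUnipotent K w x * heckeElement 2 K w 1 ^ 1 ∈ integralMonoid K v :=
  mul_mem (𝒰.level_le_integralMonoid_of_forall_mem hv 0 0 ((𝒰.globalUnipotent_mem_level_iff h𝒰 hw 0 0 x).2 hx))
    (pow_mem (heckeElement_mem_integralMonoid v w 1) 1)

variable (hUv : (𝒰.level b c).toSubmonoid ≤ integralMonoid K v) (hU'v : (𝒰.level b' c).toSubmonoid ≤ integralMonoid K v)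
  (τv : integralMonoid K v →* Module.End R V) (c₀ : ℕ)

include h𝒰 hb hbc hc hv in
/-- **`tr` commutes with every symbol operator** (`X_g ↦ [UgU]` good, `X_d ↦ ⟨d⟩`) on the integral monoid of
a family of places above `p`. [cite: Hida1994AIF, §2] [cite: KhareThorne2017, §6.2, Lemma 6.5] -/
theorem trCohomology_comp_symOp (i : ℕ) (a : 𝒰.Syms c₀) :
    (trCohomology (globalEmbedding 2 K) (integralMonoid K v) τv hUv hU'v i).hom ∘ₗ
        𝒰.symOp τv hUv c₀ (fun _ hg => 𝒰.goodElements_le_integralMonoid v hg) (fun u => diamondPi_mem_integralMonoid' v hv u) i a =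
      𝒰.symOp τv hU'v c₀ (fun _ hg => 𝒰.goodElements_le_integralMonoid v hg) (fun u => diamondPi_mem_integralMonoid' v hv u) i a ∘ₗ
        (trCohomology (globalEmbedding 2 K) (integralMonoid K v) τv hUv hU'v i).hom := by
  rcases a with ⟨g, hg⟩ | d
  · rw [symOp_inl, symOp_inl]
    exact 𝒰.trCohomology_comp_heckeCohomology_level (Δ := integralMonoid K v) τv h𝒰 hUv hU'v hb hbc hc i
      (fun w hw x hx => 𝒰.globalUnipotent_mul_heckeElement_mem_integralMonoid h𝒰 hv hw hx)
      (fun w _ hp y => ofLocal_mem_integralMonoid v (fun τ h => hp (by rw [← h]; exact hv τ)) y)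
      (𝒰.goodElements_subset_hidaElements hg) _
  · rw [symOp_inr, symOp_inr]
    exact 𝒰.trCohomology_comp_heckeCohomology_diamondPi τv h𝒰 hb hbc hc hUv hU'v d.units _ i

variable {O : Type} [CommRing O] (φ : O →+* R)

include hb hbc hc hv in
/-- **`tr (π_U(z) y) = π_{U'}(z) (tr y)`**: the transfer intertwines the polynomial actions of `O[Syms]`.
[cite: KhareThorne2017, §6.5] -/
theorem trCohomology_symPolyHom_apply (i : ℕ) (z : MvPolynomial (𝒰.Syms c₀) O)
    (y : cohomology (globalEmbedding 2 K) (integralMonoid K v) τv (𝒰.level b c) i) :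
    (trCohomology (globalEmbedding 2 K) (integralMonoid K v) τv hUv hU'v i).hom
        (𝒰.symPolyHom τv hUv c₀ (fun _ hg => 𝒰.goodElements_le_integralMonoid v hg)
          (fun u => diamondPi_mem_integralMonoid' v hv u) φ h𝒰 i z y) =
      𝒰.symPolyHom τv hU'v c₀ (fun _ hg => 𝒰.goodElements_le_integralMonoid v hg)
        (fun u => diamondPi_mem_integralMonoid' v hv u) φ h𝒰 i z
        ((trCohomology (globalEmbedding 2 K) (integralMonoid K v) τv hUv hU'v i).hom y) :=
  PolyAction.map_polyHom_apply_of_comm (φ := φ) (𝒰.symOp_comm τv hUv h𝒰 i) (𝒰.symOp_comm τv hU'v h𝒰 i) _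
    (fun a => 𝒰.trCohomology_comp_symOp h𝒰 hb hbc hc hv hUv hU'v τv c₀ i a) z y

end Equivariance

end TameLevel

end BigHeckeGLn

end Literature.NumberTheory.Automorphic
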